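import Summits.Parity.BatemanHorn.Theorems.SoloInformedThreeRangeSchema

/-!
# SoloInformedLargeDivisorEquivalence — `ψ_{n²+1}(x) ~ 𝔖x` is EQUIVALENT to Möbius–log cancellation over the large divisors

Solo unit `solo-Parity-informed` (ideation tier, informed mode), session 7; `PLAN.md` §15.3, CLAIMS C36.

With `Λ = -(μ · log) ∗ 1` split at the divisor level `D₀ = ⌊x^{1-ε}⌋` (`SoloInformedVonMangoldtSplit`),
the `ψ`-form of Hardy–Littlewood's Conjecture E for `n² + 1` differs from the LARGE-DIVISOR MÖBIUS–LOG SUM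
  `T(x; D₀) = ∑_{1 ≤ n ≤ x} ∑_{e ∣ n²+1, (n²+1)/e > D₀} μ((n²+1)/e) · log((n²+1)/e)
           = ∑_{1 ≤ n ≤ x} ∑_{d ∣ n²+1, d > D₀} μ(d) log d`
only by `x · (M(D₀) - 𝔖) - ∑_{d ≤ D₀} μ(d) log d · rem(x; d)`, which is `o(x)` as soon as
`(R1)  M(D) := -∑_{d ≤ D} μ(d) log d · ρ(d)/d → 𝔖` (prime ideal theorem strength for `ℚ(i)`; TRUE, not in
the tree, kept as a hypothesis) — the remainder range `d ≤ x^{1-ε}` being trivially `≤ C x^{1-ε²} log x`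
(`SoloInformedThreeRangeSchema.abs_sum_smallRange_le`).  Hence, for every `0 < ε < 1`:

  `isEquivalent_sum_vonMangoldt_iff_largeDivisorSum_isLittleO`:
     given (R1),   (∑_{n ≤ x} Λ(n²+1)) ~ 𝔖 x   ⟺   T(x; ⌊x^{1-ε}⌋) = o(x).

So the conjecture is exactly the statement that `μ(d) log d` exhibits an `o(1)`-per-`n` cancellation over the
divisor pairs `(n, d)`, `d ∣ n² + 1`, `d > x^{1-ε}` (trivially the sum is `O(x (log x)²)`); the conditional
schema `isEquivalent_sum_vonMangoldt_of_threeRanges` is this statement cut once more at `d = x^{1+ε}` with the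
two halves `(R2)_ε`, `(R3)_ε` asked for separately (and `(R3)_ε` in absolute value).  No bearing on the truth
of the conjecture: this file proves an equivalence of two open statements modulo a true classical one.
-/

namespace Summit.Parity.BatemanHorn.Theorems

open Finset Filter ArithmeticFunction Asymptotics
open scoped ArithmeticFunction.Moebius Topology
open Literature.NumberTheory.Sieve (hardyLittlewoodEConst hardyLittlewoodEConst_pos
  exists_card_divisors_le_mul_rpow)
open Literature.NumberTheory.Sieve.Iwaniec1978 (rho congrCount rem)

/-- The split identity of `SoloInformedVonMangoldtSplit`, rearranged: at any level `D` and for any constant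
`S`, `(ψ(x) - S x) + T(x; D) = x · (M(D) - S) - ∑_{d ≤ D} μ(d) log d · rem(x; d)`. -/
theorem sum_vonMangoldt_sub_add_largeDivisorSum_eq (x D : ℕ) (S : ℝ) :
    (∑ n ∈ Icc 1 x, Λ (n ^ 2 + 1) - S * x)
      + ∑ n ∈ Icc 1 x, ∑ e ∈ (n ^ 2 + 1).divisors with D < (n ^ 2 + 1) / e,
          (μ ((n ^ 2 + 1) / e) : ℝ) * Real.log (((n ^ 2 + 1) / e : ℕ) : ℝ)
      = (x : ℝ) * ((-∑ d ∈ Icc 1 D, (μ d : ℝ) * Real.log d * rho d / d) - S)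
        - ∑ d ∈ Icc 1 D, (μ d : ℝ) * Real.log d * rem (x : ℝ) d := by
  rw [sum_vonMangoldt_sq_add_one_eq_split x D, sum_moebius_log_congrCount_eq x D]
  ring

/-- Given `(R1)`, the error `x · (M(⌊x^{1-ε}⌋) - 𝔖) - ∑_{d ≤ x^{1-ε}} μ(d) log d · rem(x; d)` is `o(x)`
(`0 < ε < 1`). -/
theorem mainError_isLittleO {ε : ℝ} (hε : 0 < ε) (hε1 : ε < 1)
    (R1 : Tendsto (fun D : ℕ => -∑ d ∈ Icc 1 D, (μ d : ℝ) * Real.log d * rho d / d) atTop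
      (𝓝 hardyLittlewoodEConst)) :
    (fun x : ℕ => (x : ℝ) * ((-∑ d ∈ Icc 1 ⌊(x : ℝ) ^ (1 - ε)⌋₊, (μ d : ℝ) * Real.log d * rho d / d)
          - hardyLittlewoodEConst)
        - ∑ d ∈ Icc 1 ⌊(x : ℝ) ^ (1 - ε)⌋₊, (μ d : ℝ) * Real.log d * rem (x : ℝ) d)
      =o[atTop] fun x : ℕ => (x : ℝ) := by
  obtain ⟨C, hC1, hC⟩ := exists_card_divisors_le_mul_rpow hε
  rw [isLittleO_iff]
  intro c hc
  have h1 : ∀ᶠ x : ℕ in atTop,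
      |(-∑ d ∈ Icc 1 ⌊(x : ℝ) ^ (1 - ε)⌋₊, (μ d : ℝ) * Real.log d * rho d / d)
        - hardyLittlewoodEConst| ≤ c / 2 := by
    have hev := (tendsto_floor_rpow_atTop (by linarith : (0 : ℝ) < 1 - ε)).eventually
      (Metric.tendsto_nhds.mp R1 (c / 2) (by positivity))
    filter_upwards [hev] with x hx
    rw [Real.dist_eq] at hx
    exact hx.le
  have h3 := eventually_smallRange_le (C := C) hε (by linarith) (half_pos hc)
  filter_upwards [h1, h3, eventually_ge_atTop 1] with x hx1 hx3 hx
  have hx0 : (0 : ℝ) ≤ x := by positivity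
  have hfilt : (Icc 1 ⌊(x : ℝ) ^ (1 - ε)⌋₊).filter (fun d : ℕ => ¬ (x : ℝ) ^ (1 - ε) < d)
      = Icc 1 ⌊(x : ℝ) ^ (1 - ε)⌋₊ :=
    filter_true_of_mem fun d hd =>
      not_lt.mpr ((Nat.cast_le.mpr (mem_Icc.mp hd).2).trans (Nat.floor_le (by positivity)))
  have hrem : |∑ d ∈ Icc 1 ⌊(x : ℝ) ^ (1 - ε)⌋₊, (μ d : ℝ) * Real.log d * rem (x : ℝ) d|
      ≤ c / 2 * x := by
    have h := abs_sum_smallRange_le hε hC hx ⌊(x : ℝ) ^ (1 - ε)⌋₊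
    rw [hfilt] at h
    exact h.trans hx3
  have hmain : |(x : ℝ) * ((-∑ d ∈ Icc 1 ⌊(x : ℝ) ^ (1 - ε)⌋₊, (μ d : ℝ) * Real.log d * rho d / d)
      - hardyLittlewoodEConst)| ≤ x * (c / 2) := by
    rw [abs_mul, abs_of_nonneg hx0]
    exact mul_le_mul_of_nonneg_left hx1 hx0
  simp only [Real.norm_eq_abs]
  rw [abs_of_nonneg hx0]
  calc _ ≤ |(x : ℝ) * ((-∑ d ∈ Icc 1 ⌊(x : ℝ) ^ (1 - ε)⌋₊, (μ d : ℝ) * Real.log d * rho d / d)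
            - hardyLittlewoodEConst)|
          + |∑ d ∈ Icc 1 ⌊(x : ℝ) ^ (1 - ε)⌋₊, (μ d : ℝ) * Real.log d * rem (x : ℝ) d| :=
        abs_sub _ _
    _ ≤ x * (c / 2) + c / 2 * x := add_le_add hmain hrem
    _ = c * x := by ring

/-- **`ψ_{n²+1}(x) ~ 𝔖 x` ⟺ the large-divisor Möbius–log sum is `o(x)`** (given `(R1)`; any `0 < ε < 1`).
The right-hand side is `T(x; ⌊x^{1-ε}⌋) = ∑_{n ≤ x} ∑_{e ∣ n²+1, (n²+1)/e > x^{1-ε}} μ((n²+1)/e) log((n²+1)/e)`,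
i.e. `∑_{n ≤ x} ∑_{d ∣ n²+1, d > x^{1-ε}} μ(d) log d` indexed by the cofactor. -/
theorem isEquivalent_sum_vonMangoldt_iff_largeDivisorSum_isLittleO {ε : ℝ} (hε : 0 < ε) (hε1 : ε < 1)
    (R1 : Tendsto (fun D : ℕ => -∑ d ∈ Icc 1 D, (μ d : ℝ) * Real.log d * rho d / d) atTop
      (𝓝 hardyLittlewoodEConst)) :
    ((fun x : ℕ => ∑ n ∈ Icc 1 x, Λ (n ^ 2 + 1)) ~[atTop]
        fun x : ℕ => hardyLittlewoodEConst * (x : ℝ))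
      ↔ (fun x : ℕ => ∑ n ∈ Icc 1 x, ∑ e ∈ (n ^ 2 + 1).divisors with ⌊(x : ℝ) ^ (1 - ε)⌋₊ < (n ^ 2 + 1) / e,
            (μ ((n ^ 2 + 1) / e) : ℝ) * Real.log (((n ^ 2 + 1) / e : ℕ) : ℝ))
          =o[atTop] fun x : ℕ => (x : ℝ) := by
  have hS : hardyLittlewoodEConst ≠ 0 := hardyLittlewoodEConst_pos.ne'
  have hE := mainError_isLittleO hε hε1 R1
  have hid : ((fun x : ℕ => ∑ n ∈ Icc 1 x, Λ (n ^ 2 + 1))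
        - fun x : ℕ => hardyLittlewoodEConst * (x : ℝ))
      = fun x : ℕ =>
        ((x : ℝ) * ((-∑ d ∈ Icc 1 ⌊(x : ℝ) ^ (1 - ε)⌋₊, (μ d : ℝ) * Real.log d * rho d / d)
            - hardyLittlewoodEConst)
          - ∑ d ∈ Icc 1 ⌊(x : ℝ) ^ (1 - ε)⌋₊, (μ d : ℝ) * Real.log d * rem (x : ℝ) d)
        - ∑ n ∈ Icc 1 x, ∑ e ∈ (n ^ 2 + 1).divisors with ⌊(x : ℝ) ^ (1 - ε)⌋₊ < (n ^ 2 + 1) / e,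
            (μ ((n ^ 2 + 1) / e) : ℝ) * Real.log (((n ^ 2 + 1) / e : ℕ) : ℝ) := by
    funext x
    have h := sum_vonMangoldt_sub_add_largeDivisorSum_eq x ⌊(x : ℝ) ^ (1 - ε)⌋₊ hardyLittlewoodEConst
    simp only [Pi.sub_apply]
    linarith
  show ((fun x : ℕ => ∑ n ∈ Icc 1 x, Λ (n ^ 2 + 1)) - fun x : ℕ => hardyLittlewoodEConst * (x : ℝ))
      =o[atTop] (fun x : ℕ => hardyLittlewoodEConst * (x : ℝ)) ↔ _
  rw [isLittleO_const_mul_right_iff hS, hid]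
  constructor
  · intro h
    exact (hE.sub h).congr_left fun x => by ring
  · intro hT
    exact hE.sub hT

end Summit.Parity.BatemanHorn.Theorems
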